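import Literature.MathematicalPhysics.QuantumLattice.IsotropicPropagatorFourier
import Literature.MathematicalPhysics.QuantumLattice.SectorSymbolMaster
import HarnessLib

/-!
# The isotropic master symbol (Benfatto–Giuliani–Mastropietro 2006, Lemma 2.3: the `h`-uniform estimates, part 1)

Topic `Literature/MathematicalPhysics/QuantumLattice`; the isotropic companion of
`SectorChartPoint.lean` / `SectorSymbolMaster.lean`. For the ISOTROPIC rescaling all directions
scale like `r = γ^h = 4^{-n}`, so the construction is a ONE-parameter family smooth down to `r = 0`
with FIRST-order difference quotients only:

* `isoChartPoint μ (θ₀, a, b) r = p_F(θ₀) + r (a n(θ₀) + b τ(θ₀))` — smooth, `= p_F` at `r = 0`,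
  frame coordinates `(ra, rb)`; at `r = 4^{-n}` it is the spatial part of `q_F + isoChart t`
  (`splitMomentum_fermiBasePoint_add_isoChart`);
* `isoEpsFun = ε∘chart - μ` vanishes at `r = 0`, so `ε - μ = r Ē`, `Ē = isoRescaledDispersion = slopeQuot isoEpsFun`;
* `isoUFun`, `isoAngFun = truncArg ∘ u` vanishes at `r = 0`, so `= r Ā`, `Ā = isoRescaledAngle`;
* `isoMasterSymbol μ e₀ (θ₀,a,b) t₀ r = G(√(t₀² + Ē²)) ψ(u) W(Ā/π) χ(k) conj(D̄) η(|D̄|²)`, `D̄ = -it₀ + Ē`;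
* **`rescaledIsoSymbol_eq_isoMasterSymbol`** — `R̄_{n,ω̄}(t) = 4ⁿ · Φ̄(θ̄_{n,ω̄}, t₁, t₂; t₀; 4^{-n})`
  for `0 < e₀ ≤ (4+μ)/2` (the angular width `w_{2n} = π 4^{-n}` matches the parameter: `arg u / w_{2n} = Ā/π`).

Everything is PROVED; the definitions are the chart point, the two quotients, `isoUFun`,
`isoAngFun`, `isoRescaledDenom` and `isoMasterSymbol`.

## Sources

* G. Benfatto, A. Giuliani, V. Mastropietro, Ann. Henri Poincaré 7 (2006) 809–898, §2.5
  (2.58)–(2.60), Lemma 2.3 (arXiv:cond-mat/0507686 pp. 11–12). [BenfattoGiulianiMastropietro2006]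
-/

noncomputable section

open Real Set Complex Function
open scoped Topology ComplexConjugate
open Literature.Analysis.Calculus Literature.Analysis.SpecialFunctions

namespace Literature.MathematicalPhysics.QuantumLattice

/-! ### The isotropic chart point -/

/-- **The isotropic chart point** `k(θ₀, a, b; r) = p_F(θ₀) + r (a n(θ₀) + b τ(θ₀))`. [cite: BenfattoGiulianiMastropietro2006, §2.5 (2.58)] -/
def isoChartPoint (μ : ℝ) (x : ℝ × ℝ × ℝ) (r : ℝ) : Fin 2 → ℝ :=
  ![fermiX μ x.1 + r * (x.2.1 * fermiNormal μ x.1 0 + x.2.2 * fermiTangent μ x.1 0),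
    fermiY μ x.1 + r * (x.2.1 * fermiNormal μ x.1 1 + x.2.2 * fermiTangent μ x.1 1)]

/-- Components. [folklore] -/
@[simp] theorem isoChartPoint_apply_zero (μ : ℝ) (x : ℝ × ℝ × ℝ) (r : ℝ) :
    isoChartPoint μ x r 0 = fermiX μ x.1 + r * (x.2.1 * fermiNormal μ x.1 0 + x.2.2 * fermiTangent μ x.1 0) := rfl

/-- Components. [folklore] -/
@[simp] theorem isoChartPoint_apply_one (μ : ℝ) (x : ℝ × ℝ × ℝ) (r : ℝ) :
    isoChartPoint μ x r 1 = fermiY μ x.1 + r * (x.2.1 * fermiNormal μ x.1 1 + x.2.2 * fermiTangent μ x.1 1) := rfl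

/-- At `r = 0` the chart point is the Fermi point. [folklore] -/
theorem isoChartPoint_zero (μ : ℝ) (x : ℝ × ℝ × ℝ) : isoChartPoint μ x 0 = ![fermiX μ x.1, fermiY μ x.1] := by
  ext i; fin_cases i <;> simp

section Smooth

variable {μ : ℝ} (hμ₁ : -4 < μ) (hμ₂ : μ < -2 - Real.sqrt 2)
include hμ₁ hμ₂

/-- **The chart point depends smoothly on `(θ₀, a, b, r)`.** [folklore] -/
theorem contDiff_uncurry_isoChartPoint : ContDiff ℝ ((⊤ : ℕ∞) : WithTop ℕ∞) (uncurry (isoChartPoint μ)) := by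
  have hθ : ContDiff ℝ ((⊤ : ℕ∞) : WithTop ℕ∞) fun p : (ℝ × ℝ × ℝ) × ℝ => p.1.1 := contDiff_fst.comp contDiff_fst
  have ha : ContDiff ℝ ((⊤ : ℕ∞) : WithTop ℕ∞) fun p : (ℝ × ℝ × ℝ) × ℝ => p.1.2.1 := contDiff_fst.comp (contDiff_snd.comp contDiff_fst)
  have hb : ContDiff ℝ ((⊤ : ℕ∞) : WithTop ℕ∞) fun p : (ℝ × ℝ × ℝ) × ℝ => p.1.2.2 := contDiff_snd.comp (contDiff_snd.comp contDiff_fst)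
  have hs : ContDiff ℝ ((⊤ : ℕ∞) : WithTop ℕ∞) fun p : (ℝ × ℝ × ℝ) × ℝ => p.2 := contDiff_snd
  refine contDiff_pi.2 fun i => ?_
  fin_cases i
  · simp only [uncurry, isoChartPoint_apply_zero, Fin.zero_eta]
    exact ((contDiff_fermiX hμ₁ hμ₂).comp hθ).add (hs.mul ((ha.mul ((contDiff_fermiNormal_apply hμ₁ hμ₂ 0).comp hθ)).add
      (hb.mul ((contDiff_fermiTangent_apply hμ₁ hμ₂ 0).comp hθ))))
  · simp only [uncurry, isoChartPoint_apply_one, Fin.mk_one]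
    exact ((contDiff_fermiY hμ₁ hμ₂).comp hθ).add (hs.mul ((ha.mul ((contDiff_fermiNormal_apply hμ₁ hμ₂ 1).comp hθ)).add
      (hb.mul ((contDiff_fermiTangent_apply hμ₁ hμ₂ 1).comp hθ))))

/-- Frame coordinates: `k'₁ = r a`. [cite: BenfattoGiulianiMastropietro2006, §2.5 (2.58)] -/
theorem normalCoord_isoChartPoint (x : ℝ × ℝ × ℝ) (r : ℝ) : normalCoord μ x.1 (isoChartPoint μ x r) = r * x.2.1 := by
  have hn := fermiNormal_normSq hμ₁ hμ₂ x.1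
  have ht := fermiTangent_dot_fermiNormal μ x.1
  simp only [normalCoord, isoChartPoint_apply_zero, isoChartPoint_apply_one]
  linear_combination (r * x.2.1) * hn + (r * x.2.2) * ht

/-- Frame coordinates: `k'₂ = r b`. [cite: BenfattoGiulianiMastropietro2006, §2.5 (2.58)] -/
theorem tangentCoord_isoChartPoint (x : ℝ × ℝ × ℝ) (r : ℝ) : tangentCoord μ x.1 (isoChartPoint μ x r) = r * x.2.2 := by
  have hτ := fermiTangent_normSq hμ₁ hμ₂ x.1
  have ht := fermiTangent_dot_fermiNormal μ x.1
  simp only [tangentCoord, isoChartPoint_apply_zero, isoChartPoint_apply_one]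
  linear_combination (r * x.2.2) * hτ + (r * x.2.1) * ht

/-- **The isotropic chart at scale `n`**: `q_F + isoChart t` splits as `(4^{-n}t₀, isoChartPoint μ (θ₀,t₁,t₂) 4^{-n})`. [folklore] -/
theorem splitMomentum_fermiBasePoint_add_isoChart (θ₀ : ℝ) (n : ℕ) (t : MomSpace) :
    splitMomentum (fermiBasePoint μ θ₀ + isoChart hμ₁ hμ₂ θ₀ n t) =
      ((4 : ℝ) ^ (-(n : ℤ)) * t 0, isoChartPoint μ (θ₀, t 1, t 2) ((4 : ℝ) ^ (-(n : ℤ)))) := by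
  rw [splitMomentum_apply, isoChart_apply, fermiBasePoint]
  refine Prod.ext ?_ ?_
  · simp
  · ext i
    fin_cases i
    · simp only [Fin.zero_eta, Fin.isValue, Matrix.cons_val_zero, isoChartPoint_apply_zero, PiLp.add_apply,
        Matrix.cons_val_one, Matrix.cons_val_two, Matrix.tail_cons, Matrix.head_cons]
      ring
    · simp only [Fin.mk_one, Fin.isValue, Matrix.cons_val_one, Matrix.cons_val_zero, isoChartPoint_apply_one,
        PiLp.add_apply, Matrix.cons_val_two, Matrix.tail_cons, Matrix.head_cons]
      ring

end Smooth

/-! ### The rescaled dispersion (first order) -/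

/-- `isoEpsFun μ ((θ₀,a,b), r) = ε(k(θ₀,a,b;r)) - μ`. [cite: BenfattoGiulianiMastropietro2006, §2.5 (2.59)] -/
def isoEpsFun (μ : ℝ) : (ℝ × ℝ × ℝ) × ℝ → ℝ := fun p => sqDispersion (isoChartPoint μ p.1 p.2) - μ

/-- **The isotropic rescaled dispersion** `Ē = Q(isoEpsFun)`: `ε(k) - μ = r Ē`. [cite: BenfattoGiulianiMastropietro2006, §2.5 Lemma 2.3] -/
def isoRescaledDispersion (μ : ℝ) : (ℝ × ℝ × ℝ) × ℝ → ℝ := slopeQuot (isoEpsFun μ)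

section Dispersion

variable {μ : ℝ} (hμ₁ : -4 < μ) (hμ₂ : μ < -2 - Real.sqrt 2)
include hμ₁ hμ₂

/-- `isoEpsFun` is smooth. [folklore] -/
theorem contDiff_isoEpsFun : ContDiff ℝ ((⊤ : ℕ∞) : WithTop ℕ∞) (isoEpsFun μ) :=
  (contDiff_sqDispersion.comp (contDiff_uncurry_isoChartPoint hμ₁ hμ₂)).sub contDiff_const

/-- `isoEpsFun (x, 0) = 0` (the Fermi point is on the Fermi curve). [folklore] -/
theorem isoEpsFun_zero (x : ℝ × ℝ × ℝ) : isoEpsFun μ (x, 0) = 0 := by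
  simp only [isoEpsFun, isoChartPoint_zero, sqDispersion, Matrix.cons_val_zero, Matrix.cons_val_one]
  linarith [sqDispersion_fermiXY hμ₁ hμ₂ x.1]

/-- `Ē` is smooth. [folklore] -/
theorem contDiff_isoRescaledDispersion : ContDiff ℝ ((⊤ : ℕ∞) : WithTop ℕ∞) (isoRescaledDispersion μ) :=
  contDiff_slopeQuot_infty (contDiff_isoEpsFun hμ₁ hμ₂)

/-- **`ε(k) - μ = r Ē`.** [cite: BenfattoGiulianiMastropietro2006, §2.5 Lemma 2.3] -/
theorem isoEpsFun_eq_mul_isoRescaledDispersion (x : ℝ × ℝ × ℝ) (r : ℝ) :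
    isoEpsFun μ (x, r) = r * isoRescaledDispersion μ (x, r) := by
  have h := eq_add_smul_slopeQuot (contDiff_isoEpsFun hμ₁ hμ₂) (by simp) x r
  rw [isoEpsFun_zero hμ₁ hμ₂, zero_add, smul_eq_mul] at h
  exact h

end Dispersion

/-! ### The rescaled relative angle (first order) -/

/-- `u = (k₁ + ik₂) e^{-iθ₀}` at the isotropic chart point. [folklore] -/
def isoUFun (μ : ℝ) (x : ℝ × ℝ × ℝ) (r : ℝ) : ℂ := momToComplex (isoChartPoint μ x r) * exp (-((x.1 : ℝ) * I))

/-- The truncated relative angle at the isotropic chart point. [folklore] -/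
def isoAngFun (μ : ℝ) : (ℝ × ℝ × ℝ) × ℝ → ℝ := fun p =>
  truncArg (truncRadius μ) (Real.cos (7 * π / 8)) (Real.cos (15 * π / 16)) (isoUFun μ p.1 p.2)

/-- **The isotropic rescaled relative angle** `Ā = Q(isoAngFun)`: `isoAngFun = r Ā`. [cite: BenfattoGiulianiMastropietro2006, §2.5 Lemma 2.3] -/
def isoRescaledAngle (μ : ℝ) : (ℝ × ℝ × ℝ) × ℝ → ℝ := slopeQuot (isoAngFun μ)

section Angle

variable {μ : ℝ} (hμ₁ : -4 < μ) (hμ₂ : μ < -2 - Real.sqrt 2)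
include hμ₁ hμ₂

/-- `u` is smooth. [folklore] -/
theorem contDiff_uncurry_isoUFun : ContDiff ℝ ((⊤ : ℕ∞) : WithTop ℕ∞) (uncurry (isoUFun μ)) := by
  have h1 : ContDiff ℝ ((⊤ : ℕ∞) : WithTop ℕ∞) fun p : (ℝ × ℝ × ℝ) × ℝ => momToComplex (isoChartPoint μ p.1 p.2) :=
    contDiff_momToComplex.comp (contDiff_uncurry_isoChartPoint hμ₁ hμ₂)
  have h2 : ContDiff ℝ ((⊤ : ℕ∞) : WithTop ℕ∞) fun p : (ℝ × ℝ × ℝ) × ℝ => exp (-((p.1.1 : ℝ) * I)) := by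
    refine (Complex.contDiff_exp (𝕜 := ℝ)).comp ?_
    exact ((Complex.ofRealCLM.contDiff.comp (contDiff_fst.comp contDiff_fst)).mul contDiff_const).neg
  exact h1.mul h2

/-- `isoAngFun` is smooth. [folklore] -/
theorem contDiff_isoAngFun : ContDiff ℝ ((⊤ : ℕ∞) : WithTop ℕ∞) (isoAngFun μ) :=
  (contDiff_truncArg (truncRadius_pos hμ₁) cos_fifteen_lt_cos_seven neg_one_lt_cos_fifteen).comp
    (contDiff_uncurry_isoUFun hμ₁ hμ₂)

omit hμ₁ hμ₂ in
/-- At `r = 0`, `u = u(θ₀) > 0`. [folklore] -/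
theorem isoUFun_zero (x : ℝ × ℝ × ℝ) : isoUFun μ x 0 = (fermiRadius μ x.1 : ℂ) := by
  have h1 : momToComplex ![fermiX μ x.1, fermiY μ x.1] = (fermiRadius μ x.1 : ℂ) * exp ((x.1 : ℂ) * I) := by
    apply Complex.ext
    · simp [fermiX, Complex.exp_ofReal_mul_I_re]
    · simp [fermiY, Complex.exp_ofReal_mul_I_im]
  rw [isoUFun, isoChartPoint_zero, h1, mul_assoc, ← Complex.exp_add, add_neg_cancel, Complex.exp_zero, mul_one]

/-- Hence `isoAngFun (x, 0) = 0`. [folklore] -/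
theorem isoAngFun_zero (x : ℝ × ℝ × ℝ) : isoAngFun μ (x, 0) = 0 := by
  simp only [isoAngFun, isoUFun_zero, truncArg, Complex.arg_ofReal_of_nonneg (fermiRadius_pos hμ₁ hμ₂ x.1).le, mul_zero]

/-- `Ā` is smooth. [folklore] -/
theorem contDiff_isoRescaledAngle : ContDiff ℝ ((⊤ : ℕ∞) : WithTop ℕ∞) (isoRescaledAngle μ) :=
  contDiff_slopeQuot_infty (contDiff_isoAngFun hμ₁ hμ₂)

/-- **`isoAngFun = r Ā`.** [cite: BenfattoGiulianiMastropietro2006, §2.5 Lemma 2.3] -/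
theorem isoAngFun_eq_mul_isoRescaledAngle (x : ℝ × ℝ × ℝ) (r : ℝ) :
    isoAngFun μ (x, r) = r * isoRescaledAngle μ (x, r) := by
  have h := eq_add_smul_slopeQuot (contDiff_isoAngFun hμ₁ hμ₂) (by simp) x r
  rw [isoAngFun_zero hμ₁ hμ₂, zero_add, smul_eq_mul] at h
  exact h

omit hμ₁ hμ₂ in
/-- `‖u‖ = ‖k‖`. [folklore] -/
theorem norm_isoUFun (x : ℝ × ℝ × ℝ) (r : ℝ) : ‖isoUFun μ x r‖ = ‖momToComplex (isoChartPoint μ x r)‖ := by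
  rw [isoUFun, norm_mul, show -((x.1 : ℂ) * I) = ((-x.1 : ℝ) : ℂ) * I by push_cast; ring,
    Complex.norm_exp_ofReal_mul_I, mul_one]

omit hμ₁ hμ₂ in
/-- `arg u` is the relative angle. [folklore] -/
theorem arg_isoUFun (x : ℝ × ℝ × ℝ) (r : ℝ) : arg (isoUFun μ x r) = sectorRelAngle x.1 (isoChartPoint μ x r) := rfl

end Angle

/-! ### The isotropic master symbol and the identity -/

/-- The rescaled denominator `D̄ = -it₀ + Ē` (`D = r D̄`). [cite: BenfattoGiulianiMastropietro2006, §2.5 (2.59)] -/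
def isoRescaledDenom (μ : ℝ) (x : ℝ × ℝ × ℝ) (t₀ r : ℝ) : ℂ := -(I * (t₀ : ℂ)) + (isoRescaledDispersion μ (x, r) : ℂ)

/-- `|D̄|² = t₀² + Ē²`. [folklore] -/
theorem normSq_isoRescaledDenom (μ : ℝ) (x : ℝ × ℝ × ℝ) (t₀ r : ℝ) :
    Complex.normSq (isoRescaledDenom μ x t₀ r) = t₀ ^ 2 + isoRescaledDispersion μ (x, r) ^ 2 := by
  rw [isoRescaledDenom, Complex.normSq_apply]
  simp
  ring

/-- **The isotropic master symbol** `Φ̄(θ₀,a,b; t₀; r) = G(√(t₀²+Ē²)) ψ(u) W(Ā/π) χ(k) conj(D̄) η(|D̄|²)`. [cite: BenfattoGiulianiMastropietro2006, §2.5 Lemma 2.3] -/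
def isoMasterSymbol (μ e₀ : ℝ) (x : ℝ × ℝ × ℝ) (t₀ r : ℝ) : ℂ :=
  ((gnShell 4 e₀ 0 (Real.sqrt (t₀ ^ 2 + isoRescaledDispersion μ (x, r) ^ 2)) *
        truncOne (2 * truncRadius μ) (Real.cos (3 * π / 4)) (Real.cos (7 * π / 8)) (isoUFun μ x r) *
        sectorUnitWeight (isoRescaledAngle μ (x, r) / π) * zoneBump (isoChartPoint μ x r) : ℝ) : ℂ) *
    (conj (isoRescaledDenom μ x t₀ r) * (sectorInvCutoff ((e₀ / 16) ^ 2) (Complex.normSq (isoRescaledDenom μ x t₀ r)) : ℂ))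

section Identity

variable {μ : ℝ} (hμ₁ : -4 < μ) (hμ₂ : μ < -2 - Real.sqrt 2)
include hμ₁ hμ₂

/-- **The isotropic master identity**: `rescaledIsoSymbol e₀ n ω̄ t = 4ⁿ · Φ̄(θ̄_{n,ω̄}, t₁, t₂; t₀; 4^{-n})`
for `0 < e₀ ≤ (4+μ)/2`. [cite: BenfattoGiulianiMastropietro2006, §2.5 Lemma 2.3] -/
theorem rescaledIsoSymbol_eq_isoMasterSymbol {e₀ : ℝ} (he : 0 < e₀) (he' : e₀ ≤ (4 + μ) / 2) (n : ℕ) (ω : ℤ)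
    (t : MomSpace) :
    rescaledIsoSymbol hμ₁ hμ₂ e₀ n ω t =
      (((4 : ℝ) ^ n : ℝ) : ℂ) * isoMasterSymbol μ e₀ (((ω : ℝ) + 1 / 2) * sectorWidth (2 * n), t 1, t 2) (t 0) ((4 : ℝ) ^ (-(n : ℤ))) := by
  set θ₀ : ℝ := ((ω : ℝ) + 1 / 2) * sectorWidth (2 * n) with hθ₀
  set r : ℝ := (4 : ℝ) ^ (-(n : ℤ)) with hr
  set x : ℝ × ℝ × ℝ := (θ₀, t 1, t 2) with hx
  have hrpos : 0 < r := zpow_pos (by norm_num) _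
  have hr1 : r ≤ 1 := zpow_le_one_of_nonpos₀ (by norm_num) (by simp)
  have h44 : (4 : ℝ) ^ n * r = 1 := by rw [hr, zpow_neg, zpow_natCast, mul_inv_cancel₀ (by positivity)]
  have hw : sectorWidth (2 * n) = π * r := sectorWidth_two_mul n
  -- unfold the rescaled symbol at the split point
  have hsplit := splitMomentum_fermiBasePoint_add_isoChart hμ₁ hμ₂ θ₀ n t
  change genSymbol e₀ μ n (2 * n) ω (splitMomentum (fermiBasePoint μ θ₀ + isoChart hμ₁ hμ₂ θ₀ n t)) = _
  rw [hsplit]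
  set k : Fin 2 → ℝ := isoChartPoint μ x r with hk
  set E : ℝ := isoRescaledDispersion μ (x, r) with hE
  set Dt : ℂ := isoRescaledDenom μ x (t 0) r with hDt
  have hEeq : sqDispersion k - μ = r * E := isoEpsFun_eq_mul_isoRescaledDispersion hμ₁ hμ₂ x r
  have hD : sectorDenom μ (r * t 0, k) = ((r : ℝ) : ℂ) * Dt := by
    rw [sectorDenom, hDt, isoRescaledDenom]
    simp only
    rw [hEeq]
    push_cast
    ring
  have hρ : (4 : ℝ) ^ n * Real.sqrt ((r * t 0) ^ 2 + (sqDispersion k - μ) ^ 2) = Real.sqrt (t 0 ^ 2 + E ^ 2) := by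
    rw [hEeq, show (r * t 0) ^ 2 + (r * E) ^ 2 = r ^ 2 * (t 0 ^ 2 + E ^ 2) by ring, Real.sqrt_mul (sq_nonneg _),
      Real.sqrt_sq hrpos.le, ← mul_assoc, h44, one_mul]
  have hshell : scaleCutoffFn e₀ μ n (r * t 0, k) = gnShell 4 e₀ 0 (Real.sqrt (t 0 ^ 2 + E ^ 2)) := by
    rw [scaleCutoffFn_eq_gnShell_zero, hρ]
  have hLHS : genSymbol e₀ μ n (2 * n) ω (r * t 0, k) =
      ((gnShell 4 e₀ 0 (Real.sqrt (t 0 ^ 2 + E ^ 2)) * sectorWeightCirc (2 * n) ω (polarAngle k) * zoneBump k : ℝ) : ℂ) /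
        (((r : ℝ) : ℂ) * Dt) := by
    rw [genSymbol, hD, sectorCutoffGen, hshell]
  rw [hLHS, isoMasterSymbol]
  simp only [← hE, ← hDt, ← hk]
  -- off the shell
  by_cases hG : gnShell 4 e₀ 0 (Real.sqrt (t 0 ^ 2 + E ^ 2)) = 0
  · rw [hG]; simp
  have hmem := mem_Ioo_of_gnShell_zero_ne_zero he hG
  have hnSq : Complex.normSq Dt = t 0 ^ 2 + E ^ 2 := by rw [hDt, normSq_isoRescaledDenom]
  have hq₀ : 0 < (e₀ / 16) ^ 2 := by positivity
  have hnSq_ge : (e₀ / 16) ^ 2 / 2 ≤ Complex.normSq Dt := by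
    rw [hnSq]
    have h1 : (e₀ / 16) ^ 2 < Real.sqrt (t 0 ^ 2 + E ^ 2) ^ 2 := by
      have := hmem.1
      have h0 : 0 ≤ e₀ / 16 := by positivity
      nlinarith [Real.sqrt_nonneg (t 0 ^ 2 + E ^ 2)]
    rw [Real.sq_sqrt (by positivity)] at h1
    linarith
  have hDt0 : Dt ≠ 0 := by
    intro h0; rw [h0, map_zero] at hnSq_ge; linarith
  have hinv : conj Dt * (sectorInvCutoff ((e₀ / 16) ^ 2) (Complex.normSq Dt) : ℂ) = Dt⁻¹ := by
    rw [sectorInvCutoff_eq_inv hq₀ hnSq_ge, Complex.inv_def]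
  rw [hinv]
  -- off the zone
  by_cases hχ : zoneBump k = 0
  · rw [hχ]; simp
  have hkπ : ‖momToComplex k‖ ≤ π / 2 := norm_le_of_zoneBump_ne_zero hχ
  have hsc : scaleCutoffFn e₀ μ n (r * t 0, k) ≠ 0 := by rwa [hshell]
  have hR₀ : Real.sqrt ((4 + μ) / 2) ≤ ‖momToComplex k‖ := sqrt_le_norm_of_scaleCutoffFn_ne_zero he he' hsc
  have hR₀pos : 0 < Real.sqrt ((4 + μ) / 2) := Real.sqrt_pos.2 (by linarith)
  have hk0 : k ≠ 0 := by
    intro h0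
    rw [h0, (momToComplex_eq_zero_iff 0).2 rfl, norm_zero] at hR₀
    linarith
  set u : ℂ := isoUFun μ x r with hu
  have hu0 : u ≠ 0 := by
    rw [hu, ← norm_pos_iff, norm_isoUFun]; exact hR₀pos.trans_le hR₀
  have hζ : sectorWeightCirc (2 * n) ω (polarAngle k) = sectorUnitWeight (arg u / sectorWidth (2 * n)) := by
    rw [hu, arg_isoUFun]
    exact sectorWeightCirc_polarAngle_eq (2 * n) ω hk0
  have hnu : 2 * truncRadius μ ≤ ‖u‖ := by rw [two_mul_truncRadius, hu, norm_isoUFun]; exact hR₀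
  have hru : truncRadius μ ≤ ‖u‖ := by linarith [truncRadius_pos hμ₁ (μ := μ)]
  have hÃ : isoRescaledAngle μ (x, r) / π =
      truncArg (truncRadius μ) (Real.cos (7 * π / 8)) (Real.cos (15 * π / 16)) u / sectorWidth (2 * n) := by
    have h1 := isoAngFun_eq_mul_isoRescaledAngle hμ₁ hμ₂ x r
    rw [isoAngFun] at h1
    simp only at h1
    rw [← hu] at h1
    rw [hw, h1]
    field_simp
  rw [hζ, hÃ]
  by_cases harg : |arg u| ≤ 7 * π / 8
  · have htr : truncArg (truncRadius μ) (Real.cos (7 * π / 8)) (Real.cos (15 * π / 16)) u = arg u :=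
      truncArg_eq_arg_of_abs_arg_le (truncRadius_pos hμ₁) cos_fifteen_lt_cos_seven (by linarith [pi_pos]) le_rfl hru harg
    rw [htr]
    by_cases harg2 : |arg u| ≤ 3 * π / 4
    · have hone : truncOne (2 * truncRadius μ) (Real.cos (3 * π / 4)) (Real.cos (7 * π / 8)) u = 1 :=
        truncOne_eq_one_of_abs_arg_le (by linarith [truncRadius_pos hμ₁ (μ := μ)]) cos_seven_lt_cos_three (by linarith [pi_pos])
          le_rfl hnu harg2
      rw [hone, mul_one]
      have hrc : (((4 : ℝ) ^ n : ℝ) : ℂ) * ((r : ℝ) : ℂ) = 1 := by exact_mod_cast h44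
      rw [div_eq_mul_inv, mul_inv, ← eq_inv_of_mul_eq_one_left hrc]
      ring
    · push Not at harg2
      have hW : sectorUnitWeight (arg u / sectorWidth (2 * n)) = 0 := by
        apply sectorUnitWeight_eq_zero
        rw [abs_div, abs_of_pos (sectorWidth_pos (2 * n)), le_div_iff₀ (sectorWidth_pos (2 * n)), hw]
        nlinarith [pi_pos, abs_nonneg (arg u)]
      rw [hW]; simp
  · push Not at harg
    have hψ : truncOne (2 * truncRadius μ) (Real.cos (3 * π / 4)) (Real.cos (7 * π / 8)) u = 0 :=
      truncOne_eq_zero_of_le_abs_arg cos_seven_lt_cos_three (by positivity) le_rfl hu0 harg.le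
    have hW : sectorUnitWeight (arg u / sectorWidth (2 * n)) = 0 := by
      apply sectorUnitWeight_eq_zero
      rw [abs_div, abs_of_pos (sectorWidth_pos (2 * n)), le_div_iff₀ (sectorWidth_pos (2 * n)), hw]
      nlinarith [pi_pos, abs_nonneg (arg u)]
    rw [hψ, hW]; simp

end Identity

end Literature.MathematicalPhysics.QuantumLattice

end
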